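import Mathlib

/-!
# `Federbush1986.LipschitzMollifier` — [Federbush1988PhaseCellIV] Appendix A, part C, proof of Theorem A.3, (A.27)–(A.30)
# p. 342: the MOLLIFICATION of a Lipschitz map at scale `h` and its derivative bounds
# `|D^α(w^h ⋆ f)| ≤ c_α h^{−(|α|−1)} Λ₁(f)`, `|w^h ⋆ f − f| ≤ h Λ₁(f)` — PROVED (the engine behind (A.26))

statement-level skeleton of published theorems with citation tags; proofs where landed; nothing here is a claim about the Yang–Mills mass gap

CITATION HEADER.  P. Federbush, *A phase cell approach to Yang–Mills theory. IV. The choice of variables*, Commun. Math.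
Phys. **114** (1988) 317–343 [Federbush1988PhaseCellIV], Appendix A part C «Geometric Construction 5», Theorem A.3 and its
proof (A.27)–(A.31), p. 342 (render `run/shared/lean/pub/lit-balaban/lit-balaban-r19/renders/` f4-p026, read as an image by
unit `lit-balaban-r19`; statements typed in `PhaseCellIVAppAStatements` p242861 and `PhaseCellIVThmA34Repaired` p251310/p251889).
Cell `lit-balaban` (HOME `run/shared/lean/pub/lit-balaban/`), Phase-2 proof seat **p04 gen 7**; SKELETON rows **F4.ThmA.3**
(decl of record `PhaseCellIVAppA.ThmA3ContCap`, fold owner r19) and F4.EqA.27-A.29.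

WHAT IS PRINTED (p. 342).  «We pick a smoothing function `w(x) ∈ C^∞`, satisfying a) `w(x) ≥ 0`, b) `∫ w(x) = 1`, c) `w(x) = 0`,
`|x| ≥ 1` (A.27).  We define `w^h(x) = h^{−s} w(x/h)` (A.28) … Let `f^{s′}_ε(x) = ∫ w^{εd(x)}(x − y) f(y) dy` (A.30) … It is easy
to show that for `ε` small enough … satisfies the theorem.»  The content of «easy to show» that every later step uses is the
pair of estimates for the mollification `w^h ⋆ f` of a Lipschitz map `f : ℝⁿ → ℝᵗ` with Lipschitz constant `Λ₁(f) = K`: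
`|(w^h ⋆ f)(x) − f(x)| ≤ K h` and, for every order `m ≥ 1`, `‖D^m(w^h ⋆ f)(x)‖ ≤ c_m K h^{1−m}` with `c_m` depending only on
`w`, `m` and the dimension.  THIS FILE PROVES EXACTLY THESE (the variable scale `h = εd(x)` is handled in `BallSmoothing`).

THE MATHEMATICS (a derivative-free route to the derivative bounds).  For a smooth compactly supported kernel `ψ` and a
bounded continuous `w`, `‖(ψ ⋆ w)(x)‖ ≤ vol(supp ψ)·sup|ψ|·sup‖w‖`.  CORE LEMMA (`core`): `‖D^m(ψ ⋆ w)(x)‖ ≤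
vol(B_{R+m})·sup‖D^mψ‖·sup‖w‖` for `supp ψ ⊆ B_R`, by induction on `m`: `‖D^{m+1}u(x)‖ = ‖D(D^m u)(x)‖` is at most the local
Lipschitz constant of `D^m u` (`norm_fderiv_le_of_lip'`), and `D^m(ψ ⋆ w)(x + z) − D^m(ψ ⋆ w)(x) = D^m((τ_zψ − ψ) ⋆ w)(x)`
(translate the KERNEL), to which the induction hypothesis applies with `sup‖D^m(τ_zψ − ψ)‖ ≤ |z|·sup‖D^{m+1}ψ‖` (mean value
inequality).  Then for a `K`-Lipschitz `g`, translating the FUNCTION instead (`(ψ ⋆ g)(· + z) = ψ ⋆ τ_z g`,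
`sup‖τ_z g − g‖ ≤ K|z|`) gives `‖D^{m+1}(ψ ⋆ g)‖ ≤ vol(B_{1+m})·sup‖D^mψ‖·K` at unit scale, and the scale-`h` mollifier
`moll g h := (w ⋆ g(h·))(·/h)` (= `w^h ⋆ g` of (A.28)/(A.30)) inherits `‖D^{m+1}(moll g h)‖ ≤ c_m K h^{−m}` by the chain rule
for the linear map `x ↦ x/h`, and `‖moll g h − g‖ ≤ K h` from `∫ w = 1`, `w ≥ 0`, `supp w ⊆ B₁`.

WHAT THIS MODULE PROVIDES (namespace `LipschitzMollifier`; `Euc n = EuclideanSpace ℝ (Fin n)`): defs with bodies `vB`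
(volume of a ball, as a real), `bump`/`kernel` (the smoothing function `w` of (A.27): a normalised Mathlib bump function),
`moll` ((A.28)/(A.30) at a fixed scale); theorems `norm_conv_le`, `conv_add_right_kernel`, `conv_add_right_fun`,
`conv_sub_kernel`, `conv_sub_fun`, `contDiff_conv`, **`core`**, `norm_iteratedFDeriv_conv_succ_le` (unit scale, Lipschitz
`g`), `exists_bound_iteratedFDeriv_kernel`, **`contDiff_moll`**, **`norm_moll_sub_le`**, **`norm_iteratedFDeriv_moll_succ_le`**,
**`exists_moll_bound`**.  No `Prop`-valued definition, no named fact; axioms standard.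
-/

namespace Literature.MathematicalPhysics.QuantumFieldTheory.Federbush1986

noncomputable section

open MeasureTheory Metric Set Filter Function ContinuousLinearMap
open scoped Convolution ContDiff Topology NNReal

namespace LipschitzMollifier

/-- The ambient Euclidean space `ℝⁿ` of Appendix A. [cite: Federbush1988PhaseCellIV, App. A p. 339] -/
abbrev Euc (n : ℕ) : Type := EuclideanSpace ℝ (Fin n)

variable {n : ℕ} {F : Type*} [NormedAddCommGroup F] [NormedSpace ℝ F]

/-! ## §1 Convolution with a compactly supported kernel: size, translations, linearity, smoothness -/

/-- Volume of the closed ball `B_R ⊂ ℝⁿ` as a real number (the constant in `‖ψ ⋆ w‖ ≤ vol·sup|ψ|·sup‖w‖`).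
[cite: Federbush1988PhaseCellIV, (A.27) p. 342] -/
def vB (n : ℕ) (R : ℝ) : ℝ := (volume (closedBall (0 : Euc n) R)).toReal

/-- `vB ≥ 0`. [cite: Federbush1988PhaseCellIV, (A.27) p. 342] -/
theorem vB_nonneg (n : ℕ) (R : ℝ) : 0 ≤ vB n R := ENNReal.toReal_nonneg

/-- Size of a convolution: `‖(ψ ⋆ w)(x)‖ ≤ vol(B_R)·sup|ψ|·sup‖w‖` when `ψ` vanishes off `B_R`.
[cite: Federbush1988PhaseCellIV, (A.27)–(A.30) p. 342] -/
theorem norm_conv_le {ψ : Euc n → ℝ} {w : Euc n → F} {R A W : ℝ}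
    (hψR : ∀ t, t ∉ closedBall (0 : Euc n) R → ψ t = 0) (hA : ∀ t, ‖ψ t‖ ≤ A) (hW : ∀ y, ‖w y‖ ≤ W)
    (x : Euc n) : ‖(ψ ⋆[lsmul ℝ ℝ, volume] w) x‖ ≤ vB n R * A * W := by
  have hA0 : 0 ≤ A := (norm_nonneg _).trans (hA 0)
  rw [convolution_def]
  have hzero : ∀ t, t ∉ closedBall (0 : Euc n) R → (lsmul ℝ ℝ (ψ t)) (w (x - t)) = 0 := by
    intro t ht
    simp [hψR t ht]
  rw [← setIntegral_eq_integral_of_forall_compl_eq_zero hzero]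
  calc ‖∫ t in closedBall (0 : Euc n) R, (lsmul ℝ ℝ (ψ t)) (w (x - t))‖
      ≤ (A * W) * (volume (closedBall (0 : Euc n) R)).toReal := by
        refine norm_setIntegral_le_of_norm_le_const measure_closedBall_lt_top fun t _ => ?_
        rw [lsmul_apply, norm_smul]
        exact mul_le_mul (hA t) (hW _) (norm_nonneg _) hA0
    _ = vB n R * A * W := by unfold vB; ring

/-- Translating the argument = translating the KERNEL: `(ψ ⋆ w)(x + z) = (τ_zψ ⋆ w)(x)`, `τ_zψ(t) = ψ(t + z)`.
[cite: Federbush1988PhaseCellIV, (A.30) p. 342] -/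
theorem conv_add_right_kernel (ψ : Euc n → ℝ) (w : Euc n → F) (x z : Euc n) :
    (ψ ⋆[lsmul ℝ ℝ, volume] w) (x + z) = ((fun t => ψ (t + z)) ⋆[lsmul ℝ ℝ, volume] w) x := by
  simp only [convolution_def, lsmul_apply]
  rw [← integral_add_right_eq_self (fun t => ψ t • w (x + z - t)) z]
  congr 1
  ext t
  congr 2
  abel

/-- Translating the argument = translating the FUNCTION: `(ψ ⋆ w)(x + z) = (ψ ⋆ τ_z w)(x)`, `τ_z w(y) = w(y + z)`.
[cite: Federbush1988PhaseCellIV, (A.30) p. 342] -/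
theorem conv_add_right_fun (ψ : Euc n → ℝ) (w : Euc n → F) (x z : Euc n) :
    (ψ ⋆[lsmul ℝ ℝ, volume] w) (x + z) = (ψ ⋆[lsmul ℝ ℝ, volume] (fun y => w (y + z))) x := by
  simp only [convolution_def, lsmul_apply]
  congr 1
  ext t
  congr 2
  abel

/-- Linearity in the kernel: `((ψ₁ − ψ₂) ⋆ w)(x) = (ψ₁ ⋆ w)(x) − (ψ₂ ⋆ w)(x)`.
[cite: Federbush1988PhaseCellIV, (A.30) p. 342] -/
theorem conv_sub_kernel {ψ₁ ψ₂ : Euc n → ℝ} {w : Euc n → F} {x : Euc n}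
    (h₁ : ConvolutionExistsAt ψ₁ w x (lsmul ℝ ℝ) volume) (h₂ : ConvolutionExistsAt ψ₂ w x (lsmul ℝ ℝ) volume) :
    ((ψ₁ - ψ₂) ⋆[lsmul ℝ ℝ, volume] w) x =
      (ψ₁ ⋆[lsmul ℝ ℝ, volume] w) x - (ψ₂ ⋆[lsmul ℝ ℝ, volume] w) x := by
  simp only [convolution_def, lsmul_apply, Pi.sub_apply, sub_smul]
  exact integral_sub h₁ h₂

/-- Linearity in the function: `(ψ ⋆ (w₁ − w₂))(x) = (ψ ⋆ w₁)(x) − (ψ ⋆ w₂)(x)`.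
[cite: Federbush1988PhaseCellIV, (A.30) p. 342] -/
theorem conv_sub_fun {ψ : Euc n → ℝ} {w₁ w₂ : Euc n → F} {x : Euc n}
    (h₁ : ConvolutionExistsAt ψ w₁ x (lsmul ℝ ℝ) volume) (h₂ : ConvolutionExistsAt ψ w₂ x (lsmul ℝ ℝ) volume) :
    (ψ ⋆[lsmul ℝ ℝ, volume] (w₁ - w₂)) x =
      (ψ ⋆[lsmul ℝ ℝ, volume] w₁) x - (ψ ⋆[lsmul ℝ ℝ, volume] w₂) x := by
  simp only [convolution_def, lsmul_apply, Pi.sub_apply, smul_sub]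
  exact integral_sub h₁ h₂

/-- A smooth compactly supported kernel convolved with a continuous function is `C^∞`.
[cite: Federbush1988PhaseCellIV, (A.30) p. 342] -/
theorem contDiff_conv {ψ : Euc n → ℝ} {w : Euc n → F} (hc : HasCompactSupport ψ) (hψ : ContDiff ℝ ∞ ψ)
    (hw : Continuous w) : ContDiff ℝ ∞ (ψ ⋆[lsmul ℝ ℝ, volume] w) :=
  hc.contDiff_convolution_left (lsmul ℝ ℝ) hψ hw.locallyIntegrable

/-- Existence of the convolution (kernel smooth with compact support, function continuous).
[cite: Federbush1988PhaseCellIV, (A.30) p. 342] -/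
theorem convExistsAt {ψ : Euc n → ℝ} {w : Euc n → F} (hc : HasCompactSupport ψ) (hψ : Continuous ψ)
    (hw : Continuous w) (x : Euc n) : ConvolutionExistsAt ψ w x (lsmul ℝ ℝ) volume :=
  hc.convolutionExists_left_of_continuous_right (lsmul ℝ ℝ) hψ.locallyIntegrable hw x

/-! ## §2 The core lemma: `‖D^m(ψ ⋆ w)‖ ≤ vol(B_{R+m})·sup‖D^mψ‖·sup‖w‖` -/

/-- Support bookkeeping for the translated kernel: if `ψ = 0` off `B_R` and `‖z‖ ≤ 1` then `τ_zψ − ψ = 0` off `B_{R+1}`.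
[cite: Federbush1988PhaseCellIV, (A.30) p. 342] -/
theorem shiftKernel_eq_zero {ψ : Euc n → ℝ} {R : ℝ} (hψR : ∀ t, t ∉ closedBall (0 : Euc n) R → ψ t = 0)
    {z : Euc n} (hz : ‖z‖ ≤ 1) (t : Euc n) (ht : t ∉ closedBall (0 : Euc n) (R + 1)) :
    ψ (t + z) - ψ t = 0 := by
  rw [mem_closedBall, dist_zero_right, not_le] at ht
  have h1 : t ∉ closedBall (0 : Euc n) R := by
    rw [mem_closedBall, dist_zero_right, not_le]; linarith
  have h2 : t + z ∉ closedBall (0 : Euc n) R := by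
    rw [mem_closedBall, dist_zero_right, not_le]
    have h3 : ‖t‖ ≤ ‖t + z‖ + ‖z‖ := by
      have := norm_add_le (t + z) (-z)
      simpa using this
    linarith
  rw [hψR _ h2, hψR _ h1, sub_zero]

/-- Derivatives of a translate: `D^m(τ_zψ)(t) = D^mψ(t + z)`. [cite: Federbush1988PhaseCellIV, (A.30) p. 342] -/
theorem iteratedFDeriv_shift (ψ : Euc n → ℝ) (z : Euc n) (m : ℕ) (t : Euc n) :
    iteratedFDeriv ℝ m (fun s => ψ (s + z)) t = iteratedFDeriv ℝ m ψ (t + z) :=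
  iteratedFDeriv_comp_add_right m z t

/-- Mean value step: `‖D^mψ(t + z) − D^mψ(t)‖ ≤ sup‖D^{m+1}ψ‖·‖z‖`. [cite: Federbush1988PhaseCellIV, (A.30) p. 342] -/
theorem norm_iteratedFDeriv_shift_sub_le {ψ : Euc n → ℝ} (hψ : ContDiff ℝ ∞ ψ) {m : ℕ} {A : ℝ}
    (hA : ∀ t, ‖iteratedFDeriv ℝ (m + 1) ψ t‖ ≤ A) (t z : Euc n) :
    ‖iteratedFDeriv ℝ m ψ (t + z) - iteratedFDeriv ℝ m ψ t‖ ≤ A * ‖z‖ := by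
  have hψ' : ContDiff ℝ ((m + 1 : ℕ) : ℕ∞) ψ := hψ.of_le (mod_cast le_top)
  have hdiff : ∀ x ∈ (univ : Set (Euc n)), DifferentiableAt ℝ (iteratedFDeriv ℝ m ψ) x := fun x _ =>
    (hψ'.differentiable_iteratedFDeriv (m := m) (mod_cast Nat.lt_succ_self m)) x
  have hbound : ∀ x ∈ (univ : Set (Euc n)), ‖fderiv ℝ (iteratedFDeriv ℝ m ψ) x‖ ≤ A := fun x _ => by
    rw [norm_fderiv_iteratedFDeriv]; exact hA x
  have := Convex.norm_image_sub_le_of_norm_fderiv_le hdiff hbound convex_univ (mem_univ t) (mem_univ (t + z))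
  simpa using this

/-- **Core lemma.** For a smooth kernel `ψ` vanishing off `B_R` with `sup‖D^mψ‖ ≤ A` and a continuous `w` with `sup‖w‖ ≤ W`:
`‖D^m(ψ ⋆ w)(x)‖ ≤ vol(B_{R+m})·A·W` — by induction on `m`, each step bounding `‖D^{m+1}u‖ = ‖D(D^m u)‖` by the local
Lipschitz constant of `D^m u` and translating the kernel. [cite: Federbush1988PhaseCellIV, Theorem A.3 (A.26)/(A.30) p. 342] -/
theorem core (m : ℕ) : ∀ (R : ℝ) (ψ : Euc n → ℝ) (A : ℝ) (w : Euc n → F) (W : ℝ),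
    HasCompactSupport ψ → ContDiff ℝ ∞ ψ → (∀ t, t ∉ closedBall (0 : Euc n) R → ψ t = 0) →
    (∀ t, ‖iteratedFDeriv ℝ m ψ t‖ ≤ A) → Continuous w → (∀ y, ‖w y‖ ≤ W) →
    ∀ x, ‖iteratedFDeriv ℝ m (ψ ⋆[lsmul ℝ ℝ, volume] w) x‖ ≤ vB n (R + m) * A * W := by
  induction m with
  | zero =>
    intro R ψ A w W _ _ hR hA hw hW x
    rw [norm_iteratedFDeriv_zero, Nat.cast_zero, add_zero]
    exact norm_conv_le hR (fun t => by simpa [norm_iteratedFDeriv_zero] using hA t) hW x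
  | succ m ih =>
    intro R ψ A w W hc hψ hR hA hw hW x
    have hA0 : 0 ≤ A := (norm_nonneg _).trans (hA 0)
    have hW0 : 0 ≤ W := (norm_nonneg _).trans (hW 0)
    have hv0 : 0 ≤ vB n (R + ↑(m + 1)) := vB_nonneg _ _
    rw [← norm_fderiv_iteratedFDeriv]
    refine norm_fderiv_le_of_lip' ℝ (mul_nonneg (mul_nonneg hv0 hA0) hW0) ?_
    show ∀ᶠ x' in 𝓝 x, ‖iteratedFDeriv ℝ m (ψ ⋆[lsmul ℝ ℝ, volume] w) x' - iteratedFDeriv ℝ m (ψ ⋆[lsmul ℝ ℝ, volume] w) x‖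
      ≤ vB n (R + ↑(m + 1)) * A * W * ‖x' - x‖
    filter_upwards [closedBall_mem_nhds x one_pos] with x' hx'
    -- the shift `z = x' − x` and the shifted kernel `κ = τ_zψ − ψ`
    set z : Euc n := x' - x with hz_def
    have hz : ‖z‖ ≤ 1 := by rwa [mem_closedBall, dist_eq_norm] at hx'
    set κ : Euc n → ℝ := fun t => ψ (t + z) - ψ t with hκ_def
    have hτc : HasCompactSupport fun t => ψ (t + z) := hc.comp_homeomorph (Homeomorph.addRight z)
    have hτψ : ContDiff ℝ ∞ fun t => ψ (t + z) := hψ.comp (contDiff_id.add contDiff_const)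
    have hκc : HasCompactSupport κ := hτc.sub hc
    have hκ : ContDiff ℝ ∞ κ := hτψ.sub hψ
    have hκR : ∀ t, t ∉ closedBall (0 : Euc n) (R + 1) → κ t = 0 := shiftKernel_eq_zero hR hz
    have hκA : ∀ t, ‖iteratedFDeriv ℝ m κ t‖ ≤ A * ‖z‖ := by
      intro t
      have h1 : iteratedFDeriv ℝ m κ t = iteratedFDeriv ℝ m (fun s => ψ (s + z)) t - iteratedFDeriv ℝ m ψ t :=
        iteratedFDeriv_sub_apply (hτψ.of_le (mod_cast le_top)).contDiffAt (hψ.of_le (mod_cast le_top)).contDiffAt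
      rw [h1, iteratedFDeriv_shift]
      exact norm_iteratedFDeriv_shift_sub_le hψ hA t z
    -- the difference of the `m`-th derivatives is the `m`-th derivative of `κ ⋆ w`
    have hconvψ : ContDiff ℝ ∞ (ψ ⋆[lsmul ℝ ℝ, volume] w) := contDiff_conv hc hψ hw
    have hconvτ : ContDiff ℝ ∞ ((fun t => ψ (t + z)) ⋆[lsmul ℝ ℝ, volume] w) := contDiff_conv hτc hτψ hw
    have hfun : (κ ⋆[lsmul ℝ ℝ, volume] w) =
        ((fun t => ψ (t + z)) ⋆[lsmul ℝ ℝ, volume] w) - (ψ ⋆[lsmul ℝ ℝ, volume] w) := by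
      ext y
      rw [Pi.sub_apply]
      exact conv_sub_kernel (convExistsAt hτc hτψ.continuous hw y) (convExistsAt hc hψ.continuous hw y)
    have hshift : iteratedFDeriv ℝ m (ψ ⋆[lsmul ℝ ℝ, volume] w) x' =
        iteratedFDeriv ℝ m ((fun t => ψ (t + z)) ⋆[lsmul ℝ ℝ, volume] w) x := by
      have hx' : x' = x + z := by rw [hz_def]; abel
      rw [hx', ← iteratedFDeriv_comp_add_right m z x]
      congr 1
      ext y
      exact conv_add_right_kernel ψ w y z
    have key : iteratedFDeriv ℝ m (ψ ⋆[lsmul ℝ ℝ, volume] w) x' - iteratedFDeriv ℝ m (ψ ⋆[lsmul ℝ ℝ, volume] w) x =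
        iteratedFDeriv ℝ m (κ ⋆[lsmul ℝ ℝ, volume] w) x := by
      rw [hshift, hfun, iteratedFDeriv_sub_apply (hconvτ.of_le (mod_cast le_top)).contDiffAt (hconvψ.of_le (mod_cast le_top)).contDiffAt]
    rw [key]
    calc ‖iteratedFDeriv ℝ m (κ ⋆[lsmul ℝ ℝ, volume] w) x‖ ≤ vB n (R + 1 + m) * (A * ‖z‖) * W :=
          ih (R + 1) κ (A * ‖z‖) w W hκc hκ hκR hκA hw hW x
      _ = vB n (R + ↑(m + 1)) * A * W * ‖x' - x‖ := by
          rw [hz_def]; push_cast; ring_nf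

/-! ## §3 Unit-scale bound for a Lipschitz function and the scale-`h` mollifier (A.28)/(A.30) -/

/-- Unit scale: for `g` Lipschitz with constant `K`, `‖D^{m+1}(ψ ⋆ g)(x)‖ ≤ vol(B_{R+m})·sup‖D^mψ‖·K` (translate the
FUNCTION: `sup‖τ_z g − g‖ ≤ K‖z‖`). [cite: Federbush1988PhaseCellIV, Theorem A.3 (A.26)/(A.30) p. 342] -/
theorem norm_iteratedFDeriv_conv_succ_le {ψ : Euc n → ℝ} {R A : ℝ} (hc : HasCompactSupport ψ) (hψ : ContDiff ℝ ∞ ψ)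
    (hR : ∀ t, t ∉ closedBall (0 : Euc n) R → ψ t = 0) (m : ℕ) (hA : ∀ t, ‖iteratedFDeriv ℝ m ψ t‖ ≤ A)
    {g : Euc n → F} {K : ℝ≥0} (hg : LipschitzWith K g) (x : Euc n) :
    ‖iteratedFDeriv ℝ (m + 1) (ψ ⋆[lsmul ℝ ℝ, volume] g) x‖ ≤ vB n (R + m) * A * K := by
  have hA0 : 0 ≤ A := (norm_nonneg _).trans (hA 0)
  have hv0 : 0 ≤ vB n (R + m) := vB_nonneg _ _
  have hgc : Continuous g := hg.continuous
  rw [← norm_fderiv_iteratedFDeriv]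
  refine norm_fderiv_le_of_lip' ℝ (mul_nonneg (mul_nonneg hv0 hA0) K.coe_nonneg) ?_
  show ∀ᶠ x' in 𝓝 x, ‖iteratedFDeriv ℝ m (ψ ⋆[lsmul ℝ ℝ, volume] g) x' - iteratedFDeriv ℝ m (ψ ⋆[lsmul ℝ ℝ, volume] g) x‖
    ≤ vB n (R + m) * A * K * ‖x' - x‖
  filter_upwards [univ_mem] with x' _
  set z : Euc n := x' - x with hz_def
  -- the shifted function `ω = τ_z g − g`, `sup‖ω‖ ≤ K‖z‖`
  set wz : Euc n → F := fun y => g (y + z) - g y with hwz_def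
  have hτg : Continuous fun y => g (y + z) := hgc.comp (continuous_id.add continuous_const)
  have hwz : Continuous wz := hτg.sub hgc
  have hwzW : ∀ y, ‖wz y‖ ≤ K * ‖z‖ := by
    intro y
    have := hg.dist_le_mul (y + z) y
    rw [dist_eq_norm, dist_eq_norm] at this
    simpa [hwz_def] using this
  have hconvg : ContDiff ℝ ∞ (ψ ⋆[lsmul ℝ ℝ, volume] g) := contDiff_conv hc hψ hgc
  have hconvτ : ContDiff ℝ ∞ (ψ ⋆[lsmul ℝ ℝ, volume] fun y => g (y + z)) := contDiff_conv hc hψ hτg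
  have hfun : (ψ ⋆[lsmul ℝ ℝ, volume] wz) =
      (ψ ⋆[lsmul ℝ ℝ, volume] fun y => g (y + z)) - (ψ ⋆[lsmul ℝ ℝ, volume] g) := by
    ext y
    rw [Pi.sub_apply]
    exact conv_sub_fun (convExistsAt hc hψ.continuous hτg y) (convExistsAt hc hψ.continuous hgc y)
  have hshift : iteratedFDeriv ℝ m (ψ ⋆[lsmul ℝ ℝ, volume] g) x' =
      iteratedFDeriv ℝ m (ψ ⋆[lsmul ℝ ℝ, volume] fun y => g (y + z)) x := by
    have hx' : x' = x + z := by rw [hz_def]; abel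
    rw [hx', ← iteratedFDeriv_comp_add_right m z x]
    congr 1
    ext y
    exact conv_add_right_fun ψ g y z
  have key : iteratedFDeriv ℝ m (ψ ⋆[lsmul ℝ ℝ, volume] g) x' - iteratedFDeriv ℝ m (ψ ⋆[lsmul ℝ ℝ, volume] g) x =
      iteratedFDeriv ℝ m (ψ ⋆[lsmul ℝ ℝ, volume] wz) x := by
    rw [hshift, hfun, iteratedFDeriv_sub_apply (hconvτ.of_le (mod_cast le_top)).contDiffAt (hconvg.of_le (mod_cast le_top)).contDiffAt]
  rw [key]
  calc ‖iteratedFDeriv ℝ m (ψ ⋆[lsmul ℝ ℝ, volume] wz) x‖ ≤ vB n (R + m) * A * (K * ‖z‖) :=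
        core m R ψ A wz (K * ‖z‖) hc hψ hR hA hwz hwzW x
    _ = vB n (R + m) * A * K * ‖x' - x‖ := by rw [hz_def]; ring

/-- The smoothing function `w` of (A.27): «a) `w ≥ 0`, b) `∫ w = 1`, c) `w(x) = 0`, `|x| ≥ 1`» — here Mathlib's normalised bump
function with radii `1/2 < 1`. [cite: Federbush1988PhaseCellIV, (A.27) p. 342] -/
def bump (n : ℕ) : ContDiffBump (0 : Euc n) := ⟨1 / 2, 1, by norm_num, by norm_num⟩

/-- `w := bump.normed` — smooth, `≥ 0`, `∫ w = 1`, `supp w = B(0,1)`. [cite: Federbush1988PhaseCellIV, (A.27) p. 342] -/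
def kernel (n : ℕ) : Euc n → ℝ := (bump n).normed volume

/-- `w ∈ C^∞`. [cite: Federbush1988PhaseCellIV, (A.27) p. 342] -/
theorem contDiff_kernel : ContDiff ℝ ∞ (kernel n) := (bump n).contDiff_normed

/-- `w` has compact support. [cite: Federbush1988PhaseCellIV, (A.27) c) p. 342] -/
theorem hasCompactSupport_kernel : HasCompactSupport (kernel n) := (bump n).hasCompactSupport_normed

/-- (A.27) c): `w(x) = 0` for `|x| ≥ 1`. [cite: Federbush1988PhaseCellIV, (A.27) c) p. 342] -/
theorem kernel_eq_zero {t : Euc n} (ht : t ∉ closedBall (0 : Euc n) 1) : kernel n t = 0 := by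
  have hsupp : t ∉ Function.support ((bump n).normed volume) := by
    rw [(bump n).support_normed_eq]
    exact fun h => ht (ball_subset_closedBall h)
  exact Function.notMem_support.mp hsupp

/-- `sup‖D^m w‖ < ∞` (smooth with compact support). [cite: Federbush1988PhaseCellIV, (A.27) p. 342] -/
theorem exists_bound_iteratedFDeriv_kernel (m : ℕ) :
    ∃ A : ℝ, 0 ≤ A ∧ ∀ t : Euc n, ‖iteratedFDeriv ℝ m (kernel n) t‖ ≤ A := by
  obtain ⟨A, hA⟩ := ((contDiff_kernel (n := n)).continuous_iteratedFDeriv (m := m) (mod_cast le_top)).bounded_above_of_compact_support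
    (hasCompactSupport_kernel.iteratedFDeriv m)
  exact ⟨A, (norm_nonneg _).trans (hA 0), hA⟩

/-- **The scale-`h` mollifier** `moll g h := (w ⋆ g(h·))(·/h)`, i.e. `(w^h ⋆ g)(x) = ∫ w^h(x − y) g(y) dy` with
`w^h(x) = h^{−n}w(x/h)` ((A.28), (A.30) at a fixed scale), written through the unit-scale kernel and the dilation `x ↦ x/h`.
[cite: Federbush1988PhaseCellIV, (A.28)–(A.30) p. 342] -/
def moll (g : Euc n → F) (h : ℝ) (x : Euc n) : F :=
  (kernel n ⋆[lsmul ℝ ℝ, volume] (fun y => g (h • y))) (h⁻¹ • x)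

/-- The dilation `x ↦ h⁻¹x` as a continuous linear map. [cite: Federbush1988PhaseCellIV, (A.28) p. 342] -/
def dil (n : ℕ) (h : ℝ) : Euc n →L[ℝ] Euc n := h⁻¹ • ContinuousLinearMap.id ℝ (Euc n)

/-- `‖dil h‖ ≤ h⁻¹` for `h > 0`. [cite: Federbush1988PhaseCellIV, (A.28) p. 342] -/
theorem norm_dil_le {h : ℝ} (hh : 0 < h) : ‖dil n h‖ ≤ h⁻¹ := by
  unfold dil
  rw [norm_smul, Real.norm_eq_abs, abs_of_pos (inv_pos.2 hh)]
  exact mul_le_of_le_one_right (inv_pos.2 hh).le ContinuousLinearMap.norm_id_le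

/-- `moll g h = (w ⋆ g(h·)) ∘ dil h`. [cite: Federbush1988PhaseCellIV, (A.28)–(A.30) p. 342] -/
theorem moll_eq_comp (g : Euc n → F) (h : ℝ) :
    moll g h = (kernel n ⋆[lsmul ℝ ℝ, volume] (fun y => g (h • y))) ∘ (dil n h) := by
  ext x
  simp [moll, dil]

/-- **`moll g h ∈ C^∞`** for continuous `g`. [cite: Federbush1988PhaseCellIV, (A.30) p. 342] -/
theorem contDiff_moll {g : Euc n → F} (hg : Continuous g) (h : ℝ) : ContDiff ℝ ∞ (moll g h) := by
  rw [moll_eq_comp]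
  exact (contDiff_conv hasCompactSupport_kernel contDiff_kernel (hg.comp (continuous_const_smul h))).comp
    (dil n h).contDiff

/-- **`‖(w^h ⋆ g)(x) − g(x)‖ ≤ Λ₁(g)·h`** (`∫ w = 1`, `w ≥ 0`, `supp w^h ⊆ B(0,h)`).
[cite: Federbush1988PhaseCellIV, (A.27)–(A.30) p. 342] -/
theorem norm_moll_sub_le [CompleteSpace F] {g : Euc n → F} {K : ℝ≥0} (hg : LipschitzWith K g) {h : ℝ} (hh : 0 < h)
    (x : Euc n) : ‖moll g h x - g x‖ ≤ K * h := by
  have hgh : Continuous fun y : Euc n => g (h • y) := hg.continuous.comp (continuous_const_smul h)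
  have hx : g x = (fun y : Euc n => g (h • y)) (h⁻¹ • x) := by
    simp [smul_smul, mul_inv_cancel₀ hh.ne']
  rw [moll, hx, ← dist_eq_norm]
  refine (bump n).dist_normed_convolution_le hgh.aestronglyMeasurable fun y hy => ?_
  rw [mem_ball] at hy
  have hr : (bump n).rOut = 1 := rfl
  rw [hr] at hy
  calc dist (g (h • y)) (g (h • h⁻¹ • x)) ≤ K * dist (h • y) (h • h⁻¹ • x) := hg.dist_le_mul _ _
    _ = K * (h * dist y (h⁻¹ • x)) := by rw [dist_smul₀, Real.norm_eq_abs, abs_of_pos hh]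
    _ ≤ K * (h * 1) := by gcongr
    _ = K * h := by ring

/-- **`‖D^{m+1}(w^h ⋆ g)(x)‖ ≤ (vol(B_{1+m})·sup‖D^m w‖)·Λ₁(g)·h^{−m}`** — the derivative bounds of the mollification,
`|D^α f^{s′}| ≤ c_α h^{−(|α|−1)} Λ₁(f)`, at a fixed scale `h`. [cite: Federbush1988PhaseCellIV, Theorem A.3 (A.26), (A.30)
p. 342] -/
theorem norm_iteratedFDeriv_moll_succ_le {g : Euc n → F} {K : ℝ≥0} (hg : LipschitzWith K g) {h : ℝ} (hh : 0 < h)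
    (m : ℕ) {A : ℝ} (hA : ∀ t, ‖iteratedFDeriv ℝ m (kernel n) t‖ ≤ A) (x : Euc n) :
    ‖iteratedFDeriv ℝ (m + 1) (moll g h) x‖ ≤ vB n (1 + m) * A * K * (h⁻¹) ^ m := by
  have hA0 : 0 ≤ A := (norm_nonneg _).trans (hA 0)
  have hv0 : 0 ≤ vB n (1 + m) := vB_nonneg _ _
  -- the dilated function `g(h·)` is Lipschitz with constant `hK`
  have hgh : LipschitzWith (h.toNNReal * K) fun y : Euc n => g (h • y) := by
    have h1 : LipschitzWith h.toNNReal fun y : Euc n => h • y := by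
      refine LipschitzWith.of_dist_le_mul fun a b => ?_
      rw [dist_smul₀, Real.norm_eq_abs, abs_of_pos hh, Real.coe_toNNReal _ hh.le]
    have := hg.comp h1
    rwa [mul_comm] at this
  have hconv : ContDiff ℝ ∞ (kernel n ⋆[lsmul ℝ ℝ, volume] fun y => g (h • y)) :=
    contDiff_conv hasCompactSupport_kernel contDiff_kernel hgh.continuous
  have hunit := norm_iteratedFDeriv_conv_succ_le hasCompactSupport_kernel contDiff_kernel
    (fun t ht => kernel_eq_zero ht) m hA hgh (dil n h x)
  rw [moll_eq_comp, (dil n h).iteratedFDeriv_comp_right hconv x (i := m + 1) (mod_cast le_top)]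
  calc ‖(iteratedFDeriv ℝ (m + 1) (kernel n ⋆[lsmul ℝ ℝ, volume] fun y => g (h • y)) (dil n h x)).compContinuousLinearMap
          fun _ => dil n h‖
      ≤ ‖iteratedFDeriv ℝ (m + 1) (kernel n ⋆[lsmul ℝ ℝ, volume] fun y => g (h • y)) (dil n h x)‖ *
          ∏ _i : Fin (m + 1), ‖dil n h‖ := ContinuousMultilinearMap.norm_compContinuousLinearMap_le _ _
    _ ≤ (vB n (1 + m) * A * (h.toNNReal * K : ℝ≥0)) * (h⁻¹) ^ (m + 1) := by
        rw [Finset.prod_const, Finset.card_univ, Fintype.card_fin]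
        refine mul_le_mul hunit (pow_le_pow_left₀ (norm_nonneg _) (norm_dil_le hh) _) (by positivity) ?_
        positivity
    _ = vB n (1 + m) * A * K * (h⁻¹) ^ m := by
        rw [NNReal.coe_mul, Real.coe_toNNReal _ hh.le, pow_succ]
        field_simp

/-- **Packaged constants.** For every order `m ≥ 1` (written `m = k + 1`) there is `C = C(n, k) ≥ 0` such that for every
`K`-Lipschitz `g : ℝⁿ → F`, every scale `h > 0` and every point, `‖D^{k+1}(w^h ⋆ g)(x)‖ ≤ C·K·h^{−k}` — the constants
`c_α` of (A.26) for the mollification step. [cite: Federbush1988PhaseCellIV, Theorem A.3 (A.26), (A.30) p. 342] -/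
theorem exists_moll_bound (n k : ℕ) : ∃ C : ℝ, 0 ≤ C ∧ ∀ (F : Type) [NormedAddCommGroup F] [NormedSpace ℝ F]
    (g : Euc n → F) (K : ℝ≥0), LipschitzWith K g → ∀ h : ℝ, 0 < h →
    ∀ x, ‖iteratedFDeriv ℝ (k + 1) (moll g h) x‖ ≤ C * K * (h⁻¹) ^ k := by
  obtain ⟨A, hA0, hA⟩ := exists_bound_iteratedFDeriv_kernel (n := n) k
  refine ⟨vB n (1 + k) * A, mul_nonneg (vB_nonneg _ _) hA0, fun F _ _ g K hg h hh x => ?_⟩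
  exact norm_iteratedFDeriv_moll_succ_le hg hh k hA x

end LipschitzMollifier

end

end Literature.MathematicalPhysics.QuantumFieldTheory.Federbush1986
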